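import Literature.Barriers.CriticalPhenomena.HaraGaussianLemmaTorusIBP
import Literature.Barriers.CriticalPhenomena.HaraGaussianLemmaConvolution
import Literature.Barriers.CriticalPhenomena.LaceExpansionGaussianLemmaAssembly
import HarnessLib

/-!
# Hara 2008, Lemma 2.3 (the contribution from `t < T`) and `Hara2008_lem23_holds`

Third file of the proof of Hara's Lemma 2.3 (`HaraGaussianLemmaHeatKernel.lean`,
`HaraGaussianLemmaTorusIBP.lean`). PROVED here:

* `exists_norm_haraF_le_rpow_mul_jnorm_rpow` — **Lemma 2.3 in full**: under the hypotheses of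
  Thm. 1.3 on `J` (`ℤ^d`-symmetry, `Σ|x|²|J| < ∞`, the infrared bound `1 - Re Ĵ ≥ K₀|k|²/(2d)`,
  `|J(x)| ≤ K₃⟦x⟧^{-(d+2)}`; `d ≥ 1`), for all integers `0 ≤ m ≤ d` and `n⃗ ∈ ℕ^d` there is
  `c = c₆(m,n⃗)` with `|F_{n⃗}(x;t)| ≤ c t^{-(d+n-m)/2} ⟦x⟧^{-m}` for all `t > 0`, `x ∈ ℤ^d`
  (`n = Σ n_j`). Induction on `m` exactly as printed: `m = 0` is the Gaussian bound; the identity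
  (2.38) `x_l F_{n⃗} = tF_{n⃗+e_l} + Σ_p n_p F_{n⃗-e_p} * J_{p,l}` with Lemma B.1 (iii)
  (`exists_convolution_bound_iii`, `HaraGaussianLemmaConvolution.lean`; `|J_{p,l}(y)| ≤ K₃⟦y⟧^{-d}`,
  `Σ|J_{p,l}| ≤ K₂`) for `m ≥ 2`, resp. the sup bound for `m = 1`, lowers `m` by one, and
  `|x_l| = ‖x‖_∞ ≥ ⟦x⟧/√d` for the best `l`; at `x = 0` the crude bound serves for `t < 1`;
* `exists_norm_haraF_zero_le` — the case `m = d`, `n⃗ = 0⃗`: `|I_t(x)| ≤ c₆⟦x⟧^{-d}` ((2.31));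
* `haraI_eq_haraF_zero` — `I_t = F_{0⃗}` for the `haraI` of `LaceExpansionGaussianHeatKernel.lean`;
* **`Hara2008_lem23_holds : Hara2008_lem23`** — the named fact of
  `LaceExpansionGaussianLemmaAssembly.lean` is discharged. With `Hara2008_thm13_of_lemmas` (ibid.)
  and `Hara2008_gaussianConvolution_of_thm13` (`LaceExpansionGaussianLemma.lean`), the facts
  `Hara2008_thm13` and `Hara2008_gaussianConvolution` now rest on `Hara2008_lem22` alone.

## References

* T. Hara, Ann. Probab. 36 (2008) 530–593 (arXiv:math-ph/0504021): Lemma 2.3 (2.26)/(2.35) and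
  its proof (§2.4, (2.36)–(2.46)), (2.31) (the proof of (2.6) given Lemma 2.3).
-/

noncomputable section

namespace Literature.Barriers.CriticalPhenomena

open MeasureTheory Filter Finset Literature.Probability.LatticeModels Literature.Probability.Percolation
open scoped Topology BigOperators

variable {d : ℕ}

/-! ### Lemma 2.3: the induction on `m` -/

/-- `Σ_j (update n l c)_j = Σ_j n_j + c - n_l` (with real casts). [folklore] -/
theorem sum_cast_update {ι : Type*} [Fintype ι] [DecidableEq ι] (nn : ι → ℕ) (l : ι) (c : ℕ) :
    ∑ j, ((Function.update nn l c j : ℕ) : ℝ) = ∑ j, (nn j : ℝ) + c - nn l := by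
  rw [← Finset.add_sum_erase Finset.univ _ (Finset.mem_univ l),
    ← Finset.add_sum_erase Finset.univ (fun j => (nn j : ℝ)) (Finset.mem_univ l), Function.update_self]
  have h : ∑ j ∈ Finset.univ.erase l, ((Function.update nn l c j : ℕ) : ℝ) = ∑ j ∈ Finset.univ.erase l, (nn j : ℝ) :=
    Finset.sum_congr rfl fun j hj => by rw [Function.update_of_ne (Finset.ne_of_mem_erase hj)]
  rw [h]
  ring

/-- `|J_{l,p}(y)| ≤ K₃ ⟦y⟧^{-d}` when `|J(y)| ≤ K₃ ⟦y⟧^{-(d+2)}`. [cite: Hara2008, (2.42)] -/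
theorem abs_coordMul_coordMul_le_of_decay {d : ℕ} {J : Site d → ℝ} {K₃ : ℝ}
    (hdec : ∀ y, |J y| ≤ K₃ * jnorm y ^ (-((d : ℝ) + 2))) (l p : Fin d) (y : Site d) :
    |coordMul l (coordMul p J) y| ≤ K₃ * jnorm y ^ (-(d : ℝ)) := by
  have hK₃ : 0 ≤ K₃ := nonneg_of_decay hdec
  calc |coordMul l (coordMul p J) y| ≤ euclidNorm y ^ 2 * |J y| := abs_coordMul_coordMul_le l p J y
    _ ≤ euclidNorm y ^ 2 * (K₃ * jnorm y ^ (-((d : ℝ) + 2))) := mul_le_mul_of_nonneg_left (hdec y) (sq_nonneg _)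
    _ = K₃ * (euclidNorm y ^ 2 * jnorm y ^ (-((d : ℝ) + 2))) := by ring
    _ ≤ K₃ * jnorm y ^ (2 - ((d : ℝ) + 2)) := mul_le_mul_of_nonneg_left (euclidNorm_sq_mul_jnorm_rpow_neg_le y _) hK₃
    _ = K₃ * jnorm y ^ (-(d : ℝ)) := by ring_nf

section Induction

variable {n : ℕ} {J : Site (n + 1) → ℝ}

/-- One step of the `x`-space bound: for `x ≠ 0`, a coordinate `l` and `t > 0`,
`|x_l| |F_{n⃗}(x;t)| ≤ t |F_{n⃗+e_l}(x;t)| + Σ_p n_p Σ_y |J_{l,p}(y)| |F_{n⃗-e_p}(x-y;t)|`.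
[cite: Hara2008, proof of Lemma 2.3, (2.38)] -/
theorem abs_coord_mul_norm_haraF_le (hJ : Summable fun y => |J y|) (h2 : Summable fun y => euclidNorm y ^ 2 * |J y|)
    (t : ℝ) (nn : Fin (n + 1) → ℕ) (x : Site (n + 1)) (l : Fin (n + 1))
    (hbdd : ∀ p, ∃ M, ∀ z, ‖haraF J t (Function.update nn p (nn p - 1)) z‖ ≤ M) :
    |((x l : ℤ) : ℝ)| * ‖haraF J t nn x‖ ≤ |t| * ‖haraF J t (Function.update nn l (nn l + 1)) x‖ +
      ∑ p, (nn p : ℝ) * ∑' y, |coordMul l (coordMul p J) y| * ‖haraF J t (Function.update nn p (nn p - 1)) (x - y)‖ := by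
  have hpi : ((2 * Real.pi : ℂ) ^ (n + 1)) ≠ 0 := pow_ne_zero _ (by
    rw [show (2 * Real.pi : ℂ) = ((2 * Real.pi : ℝ) : ℂ) by push_cast; ring, Complex.ofReal_ne_zero]; positivity)
  have hid := coord_mul_integral_cexp_haraPhi hJ h2 t nn x l
  -- divide the identity by `(2π)^d`
  have hid' : ((x l : ℤ) : ℂ) * haraF J t nn x = (t : ℂ) * haraF J t (Function.update nn l (nn l + 1)) x +
      ∑ p, (nn p : ℂ) * ∑' y, (coordMul l (coordMul p J) y : ℂ) * haraF J t (Function.update nn p (nn p - 1)) (x - y) := by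
    have h := congrArg (fun z => z / ((2 * Real.pi : ℂ) ^ (n + 1))) hid
    rw [mul_div_assoc, add_div, mul_div_assoc, Finset.sum_div] at h
    rw [haraF, haraF, h]
    congr 1
    refine Finset.sum_congr rfl fun p _ => ?_
    rw [mul_div_assoc, integral_cexp_mul_latticeFT_haraPhi_eq_tsum hJ h2 t _ l p x]
  -- take norms
  have hsumm : ∀ p, Summable fun y => ‖(coordMul l (coordMul p J) y : ℂ) * haraF J t (Function.update nn p (nn p - 1)) (x - y)‖ := by
    intro p
    obtain ⟨M, hM⟩ := hbdd p
    refine Summable.of_nonneg_of_le (fun _ => norm_nonneg _) (fun y => ?_) ((summable_abs_coordMul_coordMul h2 l p).mul_right (max M 0))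
    rw [norm_mul, Complex.norm_real, Real.norm_eq_abs]
    exact mul_le_mul_of_nonneg_left ((hM _).trans (le_max_left _ _)) (abs_nonneg _)
  calc |((x l : ℤ) : ℝ)| * ‖haraF J t nn x‖ = ‖((x l : ℤ) : ℂ) * haraF J t nn x‖ := by
        rw [norm_mul, ← Int.cast_abs]; norm_cast
    _ = ‖(t : ℂ) * haraF J t (Function.update nn l (nn l + 1)) x +
          ∑ p, (nn p : ℂ) * ∑' y, (coordMul l (coordMul p J) y : ℂ) * haraF J t (Function.update nn p (nn p - 1)) (x - y)‖ := by
        rw [hid']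
    _ ≤ ‖(t : ℂ) * haraF J t (Function.update nn l (nn l + 1)) x‖ +
          ∑ p, ‖(nn p : ℂ) * ∑' y, (coordMul l (coordMul p J) y : ℂ) * haraF J t (Function.update nn p (nn p - 1)) (x - y)‖ :=
        (norm_add_le _ _).trans (add_le_add le_rfl (norm_sum_le _ _))
    _ ≤ _ := by
        rw [norm_mul, Complex.norm_real, Real.norm_eq_abs]
        refine add_le_add le_rfl (Finset.sum_le_sum fun p _ => ?_)
        rw [norm_mul, Complex.norm_natCast]
        refine mul_le_mul_of_nonneg_left ((norm_tsum_le_tsum_norm (hsumm p)).trans (le_of_eq ?_)) (Nat.cast_nonneg _)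
        exact tsum_congr fun y => by rw [norm_mul, Complex.norm_real, Real.norm_eq_abs]

/-- **Hara 2008, Lemma 2.3** (general form): under the hypotheses of Thm. 1.3 on `J` (symmetry,
`Σ|x|²|J| < ∞`, the infrared bound, `|J(x)| ≤ K₃⟦x⟧^{-(d+2)}`), for all integers `0 ≤ m ≤ d` and
`n⃗ ∈ ℕ^d` there is `c = c₆(m, n⃗)` with
`|F_{n⃗}(x;t)| ≤ c t^{-(d+n-m)/2} ⟦x⟧^{-m}` for all `t > 0`, `x ∈ ℤ^d` (`n = Σ n_j`), by induction on
`m`: the case `m = 0` is the Gaussian bound, and `x_l F_{n⃗} = tF_{n⃗+e_l} + Σ_p n_p F_{n⃗-e_p} * J_{p,l}`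
with Lemma B.1 (iii) (for `m ≥ 2`) resp. `Σ|J_{p,l}| ≤ K₂` (for `m = 1`) lowers `m` by one; at
`x = 0` the crude bound is used for `t < 1`. [cite: Hara2008, Lemma 2.3 and its proof (§2.4)] -/
theorem exists_norm_haraF_le_rpow_mul_jnorm_rpow (hJs : IsZdSymmetric J) (hJ : Summable fun y => |J y|)
    (h2 : Summable fun y => euclidNorm y ^ 2 * |J y|) {K₀ : ℝ} (hK₀ : 0 < K₀)
    (hlow : ∀ k ∈ cube (n + 1), K₀ * (∑ i, k i ^ 2) / (2 * ((n + 1 : ℕ) : ℝ)) ≤ 1 - (latticeFT J k).re)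
    {K₃ : ℝ} (hdec : ∀ y, |J y| ≤ K₃ * jnorm y ^ (-(((n + 1 : ℕ) : ℝ) + 2)))
    (mdeg : ℕ) (hm : mdeg ≤ n + 1) (nn : Fin (n + 1) → ℕ) :
    ∃ c : ℝ, 0 ≤ c ∧ ∀ t : ℝ, 0 < t → ∀ x : Site (n + 1),
      ‖haraF J t nn x‖ ≤ c * t ^ (-((((n + 1 : ℕ) : ℝ) + ∑ j, (nn j : ℝ) - mdeg) / 2)) * jnorm x ^ (-(mdeg : ℝ)) := by
  classical
  induction mdeg generalizing nn with
  | zero =>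
    obtain ⟨c, hc, h⟩ := exists_norm_haraF_le (d := n + 1) (by omega) hJs hJ h2 hK₀ hlow nn
    refine ⟨c, hc, fun t ht x => ?_⟩
    have := h t ht x
    simpa using this
  | succ m' ih =>
    have hm' : m' ≤ n + 1 := by omega
    have hd1 : 1 ≤ n + 1 := by omega
    set D : ℝ := ((n + 1 : ℕ) : ℝ) with hD
    have hD0 : 0 < D := by rw [hD]; positivity
    set N : ℝ := ∑ j, (nn j : ℝ) with hN
    have hN0 : 0 ≤ N := Finset.sum_nonneg fun j _ => Nat.cast_nonneg _
    set e : ℝ := -((D + N - ((m' + 1 : ℕ) : ℝ)) / 2) with he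
    have he0 : e ≤ 0 := by
      rw [he]
      have : ((m' + 1 : ℕ) : ℝ) ≤ D := by rw [hD]; exact_mod_cast hm
      linarith
    -- constants
    set K := ∑' y, euclidNorm y ^ 2 * |J y| with hK
    have hK0 : 0 ≤ K := tsum_nonneg fun y => mul_nonneg (sq_nonneg _) (abs_nonneg _)
    have hK₃ : 0 ≤ K₃ := nonneg_of_decay hdec
    set Kg : ℝ := max K K₃ with hKg
    have hKg0 : 0 ≤ Kg := hK0.trans (le_max_left _ _)
    obtain ⟨c₀, hc₀, hzero⟩ := exists_norm_haraF_le (d := n + 1) hd1 hJs hJ h2 hK₀ hlow nn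
    set Ccr : ℝ := ∏ j, (Real.pi * K) ^ (nn j) with hCcr
    have hCcr0 : 0 ≤ Ccr := Finset.prod_nonneg fun j _ => pow_nonneg (by positivity) _
    -- induction hypotheses for the neighbours of `nn`
    have hplus : ∀ l : Fin (n + 1), ∃ c : ℝ, 0 ≤ c ∧ ∀ t : ℝ, 0 < t → ∀ x : Site (n + 1),
        ‖haraF J t (Function.update nn l (nn l + 1)) x‖ ≤ c * t ^ (e - 1) * jnorm x ^ (-(m' : ℝ)) := by
      intro l
      obtain ⟨c, hc, h⟩ := ih hm' (Function.update nn l (nn l + 1))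
      refine ⟨c, hc, fun t ht x => ?_⟩
      have h' := h t ht x
      have hexp : -((D + ∑ j, ((Function.update nn l (nn l + 1) j : ℕ) : ℝ) - (m' : ℝ)) / 2) = e - 1 := by
        rw [sum_cast_update, he]; push_cast; ring
      rwa [hexp] at h'
    choose cp hcp0 hcp using hplus
    have hminus : ∀ p : Fin (n + 1), ∃ c : ℝ, 0 ≤ c ∧ (1 ≤ nn p → ∀ t : ℝ, 0 < t → ∀ x : Site (n + 1),
        ‖haraF J t (Function.update nn p (nn p - 1)) x‖ ≤ c * t ^ e * jnorm x ^ (-(m' : ℝ))) := by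
      intro p
      obtain ⟨c, hc, h⟩ := ih hm' (Function.update nn p (nn p - 1))
      refine ⟨c, hc, fun hp t ht x => ?_⟩
      have h' := h t ht x
      have hexp : -((D + ∑ j, ((Function.update nn p (nn p - 1) j : ℕ) : ℝ) - (m' : ℝ)) / 2) = e := by
        rw [sum_cast_update, he, Nat.cast_sub hp]; push_cast; ring
      rwa [hexp] at h'
    choose cm hcm0 hcm using hminus
    -- Lemma B.1 (iii) for `m' ≥ 1`
    have hiii : ∃ C : ℝ, 0 ≤ C ∧ (1 ≤ m' → ∀ (f g : Site (n + 1) → ℝ) (A Kc : ℝ),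
        (∀ y, |f y| ≤ A * jnorm y ^ (-(m' : ℝ))) → Summable (fun y => |g y|) → ∑' y, |g y| ≤ Kc →
        (∀ y, |g y| ≤ Kc * jnorm y ^ (-(((n + 1 : ℕ) : ℝ)))) →
        ∀ x, |∑' y, f y * g (x - y)| ≤ C * A * Kc * jnorm x ^ (-(m' : ℝ))) := by
      rcases Nat.eq_zero_or_pos m' with h0 | hpos
      · exact ⟨0, le_rfl, fun h => by omega⟩
      · obtain ⟨C, hC, h⟩ := exists_convolution_bound_iii (d := n + 1) hd1 (α := (m' : ℝ)) (by exact_mod_cast hpos)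
          (by exact_mod_cast (show m' < n + 1 by omega))
        exact ⟨C, hC, fun _ => h⟩
    obtain ⟨Ciii, hCiii0, hCiii⟩ := hiii
    -- the constant
    set Dc : ℝ := Ciii * Kg + Kg with hDc
    have hDc0 : 0 ≤ Dc := by positivity
    set Cl : Fin (n + 1) → ℝ := fun l => cp l + ∑ p, (nn p : ℝ) * (Dc * cm p) with hCl
    have hCl0 : ∀ l, 0 ≤ Cl l := fun l => add_nonneg (hcp0 l) (Finset.sum_nonneg fun p _ => by
      have := hcm0 p; positivity)
    have hsumCl : 0 ≤ ∑ l, Cl l := Finset.sum_nonneg fun l _ => hCl0 l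
    have hsqCl : 0 ≤ √D * ∑ l, Cl l := mul_nonneg (Real.sqrt_nonneg _) hsumCl
    set c : ℝ := √D * ∑ l, Cl l + c₀ + Ccr with hc
    refine ⟨c, add_nonneg (add_nonneg hsqCl hc₀) hCcr0, fun t ht x => ?_⟩
    have hte : 0 < t ^ e := Real.rpow_pos_of_pos ht e
    -- properties of `J_{l,p}`
    have hJg_sum : ∀ l p, Summable fun y => |coordMul l (coordMul p J) y| := fun l p => summable_abs_coordMul_coordMul h2 l p
    have hJg_K : ∀ l p, ∑' y, |coordMul l (coordMul p J) y| ≤ Kg := fun l p =>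
      (Summable.tsum_le_tsum (abs_coordMul_coordMul_le l p J) (hJg_sum l p) h2).trans (le_max_left _ _)
    have hJg_dec : ∀ l p y, |coordMul l (coordMul p J) y| ≤ Kg * jnorm y ^ (-(((n + 1 : ℕ) : ℝ))) := fun l p y =>
      (abs_coordMul_coordMul_le_of_decay hdec l p y).trans
        (mul_le_mul_of_nonneg_right (le_max_right _ _) (Real.rpow_nonneg (jnorm_pos y).le _))
    by_cases hx : x = 0
    · -- the origin
      subst hx
      rw [jnorm_zero, Real.one_rpow, mul_one]
      rcases le_or_gt 1 t with ht1 | ht1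
      · have h := hzero t ht 0
        have hexp : t ^ (-((D + N) / 2)) ≤ t ^ e :=
          Real.rpow_le_rpow_of_exponent_le ht1 (by
            rw [he]
            have : (0 : ℝ) ≤ ((m' + 1 : ℕ) : ℝ) := Nat.cast_nonneg _
            linarith)
        calc ‖haraF J t nn 0‖ ≤ c₀ * t ^ (-((D + N) / 2)) := h
          _ ≤ c₀ * t ^ e := mul_le_mul_of_nonneg_left hexp hc₀
          _ ≤ c * t ^ e := by
              refine mul_le_mul_of_nonneg_right ?_ hte.le
              rw [hc]
              linarith
      · have h := norm_haraF_le_crude hJs hJ h2 hK₀.le hlow ht.le nn 0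
        have hexp : 1 ≤ t ^ e := Real.one_le_rpow_of_pos_of_le_one_of_nonpos ht ht1.le he0
        calc ‖haraF J t nn 0‖ ≤ Ccr := h
          _ ≤ Ccr * t ^ e := le_mul_of_one_le_right hCcr0 hexp
          _ ≤ c * t ^ e := by
              refine mul_le_mul_of_nonneg_right ?_ hte.le
              rw [hc]
              linarith
    · -- `x ≠ 0`: the coordinate realising the sup norm
      obtain ⟨l, hl1, hlx⟩ := exists_coord_ge hd1 hx
      have hxl0 : 0 < |((x l : ℤ) : ℝ)| := by linarith
      have hjx := jnorm_pos x
      -- bounds on the two kinds of terms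
      have hterm1 : |t| * ‖haraF J t (Function.update nn l (nn l + 1)) x‖ ≤ cp l * t ^ e * jnorm x ^ (-(m' : ℝ)) := by
        rw [abs_of_pos ht]
        calc t * ‖haraF J t (Function.update nn l (nn l + 1)) x‖ ≤ t * (cp l * t ^ (e - 1) * jnorm x ^ (-(m' : ℝ))) :=
              mul_le_mul_of_nonneg_left (hcp l t ht x) ht.le
          _ = cp l * (t ^ (e - 1) * t) * jnorm x ^ (-(m' : ℝ)) := by ring
          _ = cp l * t ^ e * jnorm x ^ (-(m' : ℝ)) := by
              rw [Real.rpow_sub_one ht.ne', div_mul_cancel₀ _ ht.ne']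
      have hterm2 : ∀ p, (nn p : ℝ) * ∑' y, |coordMul l (coordMul p J) y| * ‖haraF J t (Function.update nn p (nn p - 1)) (x - y)‖ ≤
          (nn p : ℝ) * (Dc * cm p) * t ^ e * jnorm x ^ (-(m' : ℝ)) := by
        intro p
        rcases Nat.eq_zero_or_pos (nn p) with hp0 | hp1
        · rw [hp0]; simp
        have hF := hcm p hp1 t ht
        -- the convolution as `Σ_y f(y) g(x-y)` with `f = |F|`, `g = |J_{l,p}|`
        set f : Site (n + 1) → ℝ := fun y => ‖haraF J t (Function.update nn p (nn p - 1)) y‖ with hf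
        set g : Site (n + 1) → ℝ := fun y => |coordMul l (coordMul p J) y| with hg
        have hfg : ∑' y, |coordMul l (coordMul p J) y| * ‖haraF J t (Function.update nn p (nn p - 1)) (x - y)‖ =
            ∑' y, f y * g (x - y) := by
          rw [← tsum_comp_sub_left (fun y => f y * g (x - y)) x]
          exact tsum_congr fun y => by simp only [hf, hg, sub_sub_cancel]; ring
        have hfA : ∀ y, |f y| ≤ (cm p * t ^ e) * jnorm y ^ (-(m' : ℝ)) := fun y => by
          rw [hf, abs_of_nonneg (norm_nonneg _)]; exact hF y
        have hgabs : ∀ y, |g y| = g y := fun y => abs_of_nonneg (abs_nonneg _)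
        have hconv : |∑' y, f y * g (x - y)| ≤ Dc * (cm p * t ^ e) * jnorm x ^ (-(m' : ℝ)) := by
          rcases Nat.eq_zero_or_pos m' with h0 | hpos
          · -- `m' = 0`: sup bound
            have hf0 : ∀ y, |f y| ≤ cm p * t ^ e := fun y => by
              have := hfA y; rw [h0, Nat.cast_zero, neg_zero, Real.rpow_zero, mul_one] at this; exact this
            have hs : Summable fun y => f y * g (x - y) := by
              refine Summable.of_norm_bounded ((summable_comp_sub_left (hJg_sum l p) x).mul_left (cm p * t ^ e)) fun y => ?_
              rw [Real.norm_eq_abs, abs_mul, hgabs]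
              exact mul_le_mul_of_nonneg_right (hf0 y) (abs_nonneg _)
            calc |∑' y, f y * g (x - y)| ≤ ∑' y, (cm p * t ^ e) * g (x - y) := by
                  refine abs_tsum_le_tsum_of_le hs ((summable_comp_sub_left (hJg_sum l p) x).mul_left _) fun y => ?_
                  rw [abs_mul, hgabs]; exact mul_le_mul_of_nonneg_right (hf0 y) (abs_nonneg _)
              _ = (cm p * t ^ e) * ∑' y, g y := by rw [tsum_mul_left, tsum_comp_sub_left g x]
              _ ≤ (cm p * t ^ e) * Kg := mul_le_mul_of_nonneg_left (hJg_K l p) (by have := hcm0 p; positivity)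
              _ ≤ Dc * (cm p * t ^ e) * jnorm x ^ (-(m' : ℝ)) := by
                  rw [h0, Nat.cast_zero, neg_zero, Real.rpow_zero, mul_one, hDc]
                  have h1 : 0 ≤ cm p * t ^ e := by have := hcm0 p; positivity
                  have h2 : Kg ≤ Ciii * Kg + Kg := by nlinarith
                  nlinarith
          · have h := hCiii hpos f g (cm p * t ^ e) Kg hfA (by simpa only [hgabs] using hJg_sum l p)
              (by simpa only [hgabs] using hJg_K l p) (fun y => by rw [hgabs]; exact hJg_dec l p y) x
            calc |∑' y, f y * g (x - y)| ≤ Ciii * (cm p * t ^ e) * Kg * jnorm x ^ (-(m' : ℝ)) := h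
              _ ≤ Dc * (cm p * t ^ e) * jnorm x ^ (-(m' : ℝ)) := by
                  refine mul_le_mul_of_nonneg_right ?_ (Real.rpow_nonneg hjx.le _)
                  rw [hDc]
                  have h1 : 0 ≤ cm p * t ^ e := by have := hcm0 p; positivity
                  nlinarith
        rw [hfg]
        have hnn : 0 ≤ ∑' y, f y * g (x - y) := tsum_nonneg fun y => mul_nonneg (norm_nonneg _) (abs_nonneg _)
        rw [← abs_of_nonneg hnn] 
        calc (nn p : ℝ) * |∑' y, f y * g (x - y)| ≤ (nn p : ℝ) * (Dc * (cm p * t ^ e) * jnorm x ^ (-(m' : ℝ))) :=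
              mul_le_mul_of_nonneg_left hconv (Nat.cast_nonneg _)
          _ = _ := by ring
      -- assemble the one-step inequality
      have hbdd : ∀ p, ∃ M, ∀ z, ‖haraF J t (Function.update nn p (nn p - 1)) z‖ ≤ M := fun p =>
        ⟨_, fun z => norm_haraF_le_crude hJs hJ h2 hK₀.le hlow ht.le _ z⟩
      have hstep := abs_coord_mul_norm_haraF_le hJ h2 t nn x l hbdd
      have hmain : |((x l : ℤ) : ℝ)| * ‖haraF J t nn x‖ ≤ Cl l * t ^ e * jnorm x ^ (-(m' : ℝ)) := by
        refine hstep.trans ?_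
        calc _ ≤ cp l * t ^ e * jnorm x ^ (-(m' : ℝ)) + ∑ p, (nn p : ℝ) * (Dc * cm p) * t ^ e * jnorm x ^ (-(m' : ℝ)) :=
              add_le_add hterm1 (Finset.sum_le_sum fun p _ => hterm2 p)
          _ = Cl l * t ^ e * jnorm x ^ (-(m' : ℝ)) := by simp only [hCl, add_mul, Finset.sum_mul]
      -- divide by `|x_l| ≥ ⟦x⟧/√d`
      have hCl_le : Cl l ≤ ∑ l', Cl l' := Finset.single_le_sum (fun l' _ => hCl0 l') (Finset.mem_univ l)
      have hpow : jnorm x ^ (-(m' : ℝ)) = jnorm x * jnorm x ^ (-((m' + 1 : ℕ) : ℝ)) := by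
        rw [show (-((m' + 1 : ℕ) : ℝ)) = -(m' : ℝ) - 1 by push_cast; ring, Real.rpow_sub_one hjx.ne']
        field_simp
      calc ‖haraF J t nn x‖ = (|((x l : ℤ) : ℝ)| * ‖haraF J t nn x‖) / |((x l : ℤ) : ℝ)| := by
            field_simp
        _ ≤ (Cl l * t ^ e * jnorm x ^ (-(m' : ℝ))) / |((x l : ℤ) : ℝ)| := div_le_div_of_nonneg_right hmain hxl0.le
        _ = Cl l * t ^ e * jnorm x ^ (-((m' + 1 : ℕ) : ℝ)) * (jnorm x / |((x l : ℤ) : ℝ)|) := by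
            rw [hpow]; ring
        _ ≤ Cl l * t ^ e * jnorm x ^ (-((m' + 1 : ℕ) : ℝ)) * √D := by
            refine mul_le_mul_of_nonneg_left ?_ (mul_nonneg (mul_nonneg (hCl0 l) hte.le) (Real.rpow_nonneg hjx.le _))
            rw [div_le_iff₀ hxl0, hD]; exact hlx
        _ = (√D * Cl l) * t ^ e * jnorm x ^ (-((m' + 1 : ℕ) : ℝ)) := by ring
        _ ≤ c * t ^ e * jnorm x ^ (-((m' + 1 : ℕ) : ℝ)) := by
            refine mul_le_mul_of_nonneg_right (mul_le_mul_of_nonneg_right ?_ hte.le) (Real.rpow_nonneg hjx.le _)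
            rw [hc]
            have h1 : √D * Cl l ≤ √D * ∑ l', Cl l' := mul_le_mul_of_nonneg_left hCl_le (Real.sqrt_nonneg _)
            linarith

end Induction

/-- **Hara 2008, Lemma 2.3, the case used for Theorem 1.3** (`m = d`, `n⃗ = 0⃗`): under the
hypotheses of Thm. 1.3 on the kernel `J` (bundled in `HaraKernelHyp d J ρ`; `d ≥ 1`), there is
`c₆ = c₆(d, 0⃗)` with `|I_t(x)| ≤ c₆ ⟦x⟧^{-d}` for all `t > 0` and `x ∈ ℤ^d` — whence
`|C_<(x)| ≤ T c₆ ⟦x⟧^{-d}` ((2.31)). [cite: Hara2008, Lemma 2.3 ((2.35) with n⃗ = 0⃗, m = d) and (2.31)] -/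
theorem exists_norm_haraF_zero_le {d : ℕ} (hd : 1 ≤ d) {J : Site d → ℝ} {ρ : ℝ} (hK : HaraKernelHyp d J ρ) :
    ∃ c : ℝ, 0 ≤ c ∧ ∀ t : ℝ, 0 < t → ∀ x : Site d, ‖haraF J t 0 x‖ ≤ c * jnorm x ^ (-(d : ℝ)) := by
  obtain ⟨n, rfl⟩ : ∃ n, d = n + 1 := ⟨d - 1, by omega⟩
  obtain ⟨K₀, hK₀, hlow⟩ := hK.lower
  obtain ⟨K₃, hdec⟩ := hK.decay
  have hdec' : ∀ y, |J y| ≤ K₃ * jnorm y ^ (-(((n + 1 : ℕ) : ℝ) + 2)) := fun y => by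
    rw [← div_jnorm_rpow_eq]; exact hdec y
  obtain ⟨c, hc, h⟩ := exists_norm_haraF_le_rpow_mul_jnorm_rpow hK.symm hK.hasSum_one.summable.abs hK.summable_sq
    hK₀ hlow hdec' (n + 1) le_rfl 0
  refine ⟨c, hc, fun t ht x => ?_⟩
  have h' := h t ht x
  simp only [Pi.zero_apply, Nat.cast_zero, Finset.sum_const_zero, add_zero, sub_self, zero_div, neg_zero,
    Real.rpow_zero, mul_one] at h'
  exact h'

/-- Hara's `I_t(x)` (`haraI` of `LaceExpansionGaussianHeatKernel.lean`) is `F_{0⃗}(x;t)`. [cite: Hara2008, (2.2) and (2.32)] -/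
theorem haraI_eq_haraF_zero {d : ℕ} (J : Site d → ℝ) (t : ℝ) (x : Site d) : haraI J t x = haraF J t 0 x := by
  unfold haraI haraF
  congr 1
  refine integral_congr_ae (Eventually.of_forall fun k => ?_)
  simp [haraPhi, heatFT]

/-- **`Hara2008_lem23` holds**: the named fact of `LaceExpansionGaussianLemmaAssembly.lean`
(Hara 2008, Lemma 2.3 in the case `m = d`, `n⃗ = 0⃗`: `|I_t(x)| ≤ c₆ ⟦x⟧^{-d}` for all `t > 0`, `x`,
under `HaraKernelHyp d J ρ`, `d ≥ 3`) is a theorem, by the general Lemma 2.3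
`exists_norm_haraF_le_rpow_mul_jnorm_rpow` (which needs only `d ≥ 1`).
[cite: Hara2008, Lemma 2.3 (2.26)/(2.35) and the proof of (2.6)] -/
theorem Hara2008_lem23_holds : Hara2008_lem23 := by
  intro d hd J ρ hK
  obtain ⟨c, -, h⟩ := exists_norm_haraF_zero_le (by omega) hK
  exact ⟨c, fun t ht x => by rw [haraI_eq_haraF_zero]; exact h t ht x⟩


end Literature.Barriers.CriticalPhenomena
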